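import Summits.AtomisticToContinuum.BoseEinsteinCondensation.Theorems.BECThomsonPrincipleGDTransferSeededWitnessDefs

/-!
# Route `BECThomsonPrinciple`, crux `GDTransfer` (stmt-AtomisticToContinuum-9482), line `seeded-continuity`:
# fourth Defs file — the `n̂₀`-GRADING of the energy form and the FIXED-`N` SEED programme (lead c2)

`Defs` file (D-0016) continuing `…SeededDefs` (p137609), `…SeededWitnessDefs` (p139431), `…SeededRoughDefs` (p147682).
The one open stub of the soft half of the line is the SEED `stub_noBalancedCat : NoBalancedCat` — "along the dilute path
the `n̂₀`-law of a near-minimiser is never a balanced cat", with the threshold `τ < 1/2` chosen BEFORE the particle number.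
This file types the lead's supports programme isolating the seed's open content as exactly that uniformity: the same
statement with `τ` chosen AFTER `N` (`FixedNNoBalancedCat`) is provable with tree technology, through

* the `n̂₀`-GRADING of the energy form (new infrastructure, reusable by any quantitative attack on the seed): the kinetic
  form is DIAGONAL in the crux's `Q_S`-decomposition (`KineticBlockDiagonal`: `∂_{x_l}P_l = 0`, `[∂_{x_j}, P_l] = 0`,
  `P_l` self-adjoint), and the interaction form has `Q_S`-BANDWIDTH TWO (`InteractionLocality`: a pair potential
  `v(x_p − x_q)` commutes with every slot average `P_l`, `l ∉ {p,q}`, so `𝓥(Q_S f, Q_T f) = 0` as soon as `T ∖ S` has three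
  elements) — "H = T + V is band-diagonal in the `n̂₀`-grading";
* the SHARP-CUT SPLITTING (`SectorBlockAlgebra`, `SharpCutSplitting`): cutting a state at `n̂₀ = j` into the blocks
  `Ψ_{<j} = Σ_{|S|<j} Q_SΨ`, `Ψ_{≥j}` gives two orthogonal directions with `𝓔(Ψ_{<j}) + 𝓔(Ψ_{≥j}) ≤ 𝓔(Ψ) + C·P_Ψ(j−2 ≤ n̂₀ ≤ j+1)`
  (`C` = a bound of the interaction on the cell), the only cross terms being interaction terms across the cut;
* POINTWISE CAT EXCLUSION (`PointwiseCatExclusion`): at each fixed `(N, L)` a balanced cat with a thin middle band would split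
  into two orthogonal near-minimisers, contradicting the phase stability of near-minimisers (`seeded_nearMinimisers_phase_close`,
  from the PROVED simplicity of the bosonic torus ground state) — so some `τ_{N,L} < 1/2` excludes cats;
* LOCAL CONSTANCY OF THE WHOLE LAW (`LawLocalConstancy`: the landed `stub_localConstancy` for an arbitrary set of counts, same
  proof) and COMPACTNESS of the side path `[L_min, A·N]` plus the free corner beyond `A·N` ⇒ `FixedNNoBalancedCat`.

Juxtaposition (the point of the programme): `NoBalancedCat = ∀ v θ β, ∃ τ < 1/2, ∃ ρ₀ N₀, ∀ N ≥ N₀, ∀ L ≥ (N/ρ₀)^{1/3}, …`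
versus `FixedNNoBalancedCat = ∀ v θ β, ∃ N₀, ∀ N ≥ N₀, ∀ L_min > 0, ∃ τ < 1/2, ∀ L ≥ L_min, …` — what remains open of the seed
is the uniformity of `τ` in `N` alone (thermodynamic-limit control of the depleted branch, to which the reference-mode-0
Gaussian-domination hypothesis is blind: Cruxes/GDTransfer/STRATEGY-CENSUS.md §0, line card v4).

Objects: `sectorBlock`; statements `KineticBlockDiagonal`, `InteractionLocality`, `SectorBlockAlgebra`, `SharpCutSplitting`,
`PointwiseCatExclusion`, `LawLocalConstancy`, `FixedNNoBalancedCat`; sanity `sectorBlock_congr`, `lawLocalConstancy_hi`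
(the landed `LocalConstancy` is the instance `p = (1−β)N ≤ ·`).  Nothing open is asserted: every `def … : Prop` is a statement
consumed only as the type of a supports theorem or as an explicit hypothesis.

References: ReedSimonIV1978 Thm XIII.1, §XIII.12 (IMS-type localisation; nondegenerate ground states); LSSY2005 §1.2, Ch. 5
(footnote to (5.3), scaling); KennedyLiebShastry1988 (the transfer the seed would complete).
-/

noncomputable section

open MeasureTheory Filter
open scoped ENNReal NNReal ComplexConjugate

namespace Summit.AtomisticToContinuum.BoseEinsteinCondensation.Cruxes.GDTransfer.Seeded

open Literature.MathematicalPhysics.QuantumManyBody.BoseGas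
open Summit.AtomisticToContinuum.BoseEinsteinCondensation.Theorems.GaussianDominationCan.Negative (modeProj)
open Summit.AtomisticToContinuum.BoseEinsteinCondensation.Cruxes.GDTransfer.DysonDressedWitness (IsDirection mass eform)

variable {m : ℕ}

/-! ## §0 Vocabulary: blocks of the `n̂₀`-grading -/

/-- The BLOCK `Σ_{S : p |S|} Q_S ψ` of `ψ` in the `n̂₀`-sectors selected by a set of counts `p` (so
`sectorBlock (· < j) ψ = Ψ_{<j} = 𝟙(n̂₀ < j)ψ`; `mass (sectorBlock p ψ) = lawMass p ψ`). -/
def sectorBlock (m : ℕ) (L : ℝ) (p : ℕ → Prop) [DecidablePred p] (ψ : Config (m + 1) → ℂ) :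
    Config (m + 1) → ℂ :=
  ∑ S ∈ (Finset.univ : Finset (Finset (Fin (m + 1)))).filter (fun S => p S.card), modeProj (m + 1) L S ψ

/-! ## §1 The `n̂₀`-grading of the energy form -/

/-- THE KINETIC FORM IS DIAGONAL IN THE `Q_S`-DECOMPOSITION: `t(Q_S f, Q_T f) = 0` for `S ≠ T` and `C¹` `f`.
Mechanism: pick `l ∈ S ∆ T`, say `l ∈ S ∖ T`; the `j = l` terms vanish because `∂_{x_l}(P_l ·) = 0`
(`fderiv_cellAvg_single_self`, `Q_S f = P_l Q_S f`); for `j ≠ l`, `∂_{x_j}` commutes with `P_l`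
(`fderiv_cellAvg_single_of_ne`), `P_l` is self-adjoint on the cell (`integral_conj_mul_cellAvg`) and `P_l Q_T f = 0`
(`cellAvg_modeProj`). -/
def KineticBlockDiagonal : Prop :=
  ∀ (m : ℕ) (L : ℝ), 0 < L → ∀ (S T : Finset (Fin (m + 1))), S ≠ T →
    ∀ f : Config (m + 1) → ℂ, ContDiff ℝ 1 f → tform m L (modeProj (m + 1) L S f) (modeProj (m + 1) L T f) = 0

/-- THE INTERACTION FORM HAS `Q_S`-BANDWIDTH TWO (finite continuous profiles): `𝓥(Q_S f, Q_T f) = 0` whenever `T ∖ S`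
has at least three elements (in particular whenever `|S| + 3 ≤ |T|`).  Mechanism, pair by pair: for the pair `{p, q}` pick
`l ∈ T ∖ S ∖ {p, q}`; `v^per(x_p − x_q)` does not depend on `x_l` (`pairWeight_update`), so it commutes with the slot average
`P_l`, which is self-adjoint and kills one side (`Q_S f = (1 − P_l)Q_S f`, i.e. `P_l Q_S f = 0`, while `Q_T f = P_l Q_T f`). -/
def InteractionLocality : Prop :=
  ∀ v : ℝ → ℝ≥0∞, IsRepulsiveFiniteRange v → IsFiniteContinuous v →
    ∀ (m : ℕ) (L : ℝ), 0 < L → ∀ (S T : Finset (Fin (m + 1))), 3 ≤ (T \ S).card →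
      ∀ f : Config (m + 1) → ℂ, Continuous f → vform v m L (modeProj (m + 1) L S f) (modeProj (m + 1) L T f) = 0

/-! ## §2 The sharp cut -/

/-- ALGEBRA OF SECTOR BLOCKS: for every set of counts `p`, the block of a periodic trial state is a direction (C¹,
periodic, Bose-symmetric — `p` sees only `|S|`), its mass is the law mass `P_Ψ(n̂₀ ∈ p)`, the blocks of `p` and `¬p`
resolve the state, and they are orthogonal (`Q_S ⊥ Q_T` for `S ≠ T`). -/
def SectorBlockAlgebra : Prop :=
  ∀ (m : ℕ) (L : ℝ), 0 < L → ∀ (p : ℕ → Prop) [DecidablePred p] (Ψ : PeriodicTrialState (m + 1) L),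
    IsDirection m L (sectorBlock m L p Ψ.ψ) ∧
    mass L (sectorBlock m L p Ψ.ψ) = lawMass m L p Ψ.ψ ∧
    (∀ X, sectorBlock m L p Ψ.ψ X + sectorBlock m L (fun i => ¬ p i) Ψ.ψ X = Ψ.ψ X) ∧
    ∫ X in cellN (m + 1) L, conj (sectorBlock m L p Ψ.ψ X) * sectorBlock m L (fun i => ¬ p i) Ψ.ψ X = 0

/-- THE SHARP-CUT SPLITTING INEQUALITY (finite continuous profiles): if the interaction is bounded by `C` on
configuration space, cutting a periodic trial state at `n̂₀ = j` costs at most `C` times the mass of the four sectors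
`j − 2 ≤ n̂₀ ≤ j + 1` around the cut:  `𝓔(Ψ_{<j}) + 𝓔(Ψ_{¬<j}) ≤ E(Ψ) + C · P_Ψ(j−2 ≤ n̂₀ ≤ j+1)`.
Mechanism: `𝓔(A + B) = 𝓔(A) + 𝓔(B) + 2 Re (t(A,B) + 𝓥(A,B))` (`eform_line_toReal`); `t(A, B) = 0` by
`KineticBlockDiagonal`; by `InteractionLocality` only the sectors `|S| ∈ {j−2, j−1}` of `A` and `|T| ∈ {j, j+1}` of `B`
talk, and `2|𝓥(A', B')| ≤ 2C‖A'‖‖B'‖ ≤ C(‖A'‖² + ‖B'‖²)`. -/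
def SharpCutSplitting : Prop :=
  ∀ v : ℝ → ℝ≥0∞, IsRepulsiveFiniteRange v → IsFiniteContinuous v →
    ∀ (m : ℕ) (L : ℝ), 0 < L → ∀ C : ℝ≥0, (∀ X : Config (m + 1), periodicInteraction v L X ≤ C) →
      ∀ (Ψ : PeriodicTrialState (m + 1) L) (j : ℕ),
        eform v L (sectorBlock m L (fun i => i < j) Ψ.ψ) + eform v L (sectorBlock m L (fun i => ¬ i < j) Ψ.ψ) ≤
          periodicEnergy v Ψ + C * lawMass m L (fun i => j ≤ i + 2 ∧ i ≤ j + 1) Ψ.ψ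

/-! ## §3 The fixed-`N` seed -/

/-- POINTWISE CAT EXCLUSION (finite continuous profiles): for band parameters `θ, β` there is `N₀` such that at every FIXED
`(N, L)` with `N ≥ N₀`, `L > 0` some threshold `τ < 1/2` and slack `δ > 0` exclude balanced cats among the `δ`-near-minimisers
— `τ` chosen AFTER `(N, L)`.  Mechanism: a `τ`-balanced law with `τ` near `1/2` has middle-band mass `≤ 1 − 2τ`; cut inside the
band (`SharpCutSplitting`, `N₀` makes the band five sectors wide): both blocks are near-minimisers of mass `≥ τ`, orthogonal,
contradicting `seeded_nearMinimisers_phase_close`. -/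
def PointwiseCatExclusion : Prop :=
  ∀ v : ℝ → ℝ≥0∞, IsRepulsiveFiniteRange v → IsFiniteContinuous v →
    ∀ θ β : ℝ, 0 < θ → 0 < β → θ + β < 1 → ∃ N₀ : ℕ, ∀ m : ℕ, N₀ ≤ m + 1 → ∀ L : ℝ, 0 < L →
      ∃ τ : ℝ, 0 < τ ∧ τ < 1 / 2 ∧ ∃ δ : ℝ≥0∞, 0 < δ ∧ ∀ Ψ : PeriodicTrialState (m + 1) L,
        periodicEnergy v Ψ ≤ periodicGroundStateEnergy v (m + 1) L + δ →
        ¬ (ENNReal.ofReal τ ≤ loMass m L θ Ψ.ψ ∧ ENNReal.ofReal τ ≤ hiMass m L β Ψ.ψ)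

/-- LOCAL CONSTANCY OF THE WHOLE LAW OF NEAR-MINIMISERS IN THE SIDE (fixed `N`; the landed `LocalConstancy v` is the instance
`p = ((1−β)N ≤ ·)`): for every set of counts `p`, side `L₁ > 0` and `ε > 0` there are a radius `r > 0` and a slack `δ₁ > 0` such that
for every side `L'` with `|L' − L₁| < r` some slack `δ' > 0` makes `P(n̂₀ ∈ p)` of every `δ'`-near-minimiser at `L'` and of every
`δ₁`-near-minimiser at `L₁` agree within `ε`.  Same proof as `stub_localConstancy` (dilation transport `lawMass_dilate` + law stability
`lawMass_le_of_nearMinimisers`, both landed for general `p`). -/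
def LawLocalConstancy (v : ℝ → ℝ≥0∞) : Prop :=
  ∀ (m : ℕ) (p : ℕ → Prop) [DecidablePred p] (L₁ : ℝ), 0 < L₁ → ∀ ε : ℝ, 0 < ε →
    ∃ r : ℝ, 0 < r ∧ ∃ δ₁ : ℝ≥0∞, 0 < δ₁ ∧ ∀ L' : ℝ, |L' - L₁| < r →
      ∃ δ' : ℝ≥0∞, 0 < δ' ∧
        ∀ (Ψ' : PeriodicTrialState (m + 1) L') (Ψ₁ : PeriodicTrialState (m + 1) L₁),
          periodicEnergy v Ψ' ≤ periodicGroundStateEnergy v (m + 1) L' + δ' →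
          periodicEnergy v Ψ₁ ≤ periodicGroundStateEnergy v (m + 1) L₁ + δ₁ →
          (lawMass m L' p Ψ'.ψ).toReal ≤ (lawMass m L₁ p Ψ₁.ψ).toReal + ε ∧
            (lawMass m L₁ p Ψ₁.ψ).toReal ≤ (lawMass m L' p Ψ'.ψ).toReal + ε

/-- THE FIXED-`N` SEED (finite continuous profiles): `NoBalancedCat` with the threshold chosen AFTER the particle number —
for band parameters `θ, β` there is `N₀` such that for every `N ≥ N₀` and every `L_min > 0` ONE threshold `τ < 1/2` excludes
balanced cats among the small-slack near-minimisers at EVERY side `L ≥ L_min`.  Mechanism: `PointwiseCatExclusion` at each side,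
spread to a neighbourhood by `LawLocalConstancy` (for the depleted and the condensed side), a finite subcover of the compact
stretch `[L_min, A·N]`, and the free corner beyond `A·N` (`FreeCorner`: the depleted-side mass is `< 1/4` there by Markov and
`CountLaw`). -/
def FixedNNoBalancedCat : Prop :=
  ∀ v : ℝ → ℝ≥0∞, IsRepulsiveFiniteRange v → IsFiniteContinuous v →
    ∀ θ β : ℝ, 0 < θ → 0 < β → θ + β < 1 → ∃ N₀ : ℕ, ∀ m : ℕ, N₀ ≤ m + 1 → ∀ Lmin : ℝ, 0 < Lmin →
      ∃ τ : ℝ, 0 < τ ∧ τ < 1 / 2 ∧ ∀ L : ℝ, Lmin ≤ L →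
        ∃ δ : ℝ≥0∞, 0 < δ ∧ ∀ Ψ : PeriodicTrialState (m + 1) L,
          periodicEnergy v Ψ ≤ periodicGroundStateEnergy v (m + 1) L + δ →
          ¬ (ENNReal.ofReal τ ≤ loMass m L θ Ψ.ψ ∧ ENNReal.ofReal τ ≤ hiMass m L β Ψ.ψ)

/-! ## §4 Sanity (sorry-free) -/

/-- Blocks depend on the set of counts only through its extension. -/
theorem sectorBlock_congr {p q : ℕ → Prop} [DecidablePred p] [DecidablePred q] (h : ∀ i, p i ↔ q i)
    (m : ℕ) (L : ℝ) (ψ : Config (m + 1) → ℂ) : sectorBlock m L p ψ = sectorBlock m L q ψ := by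
  unfold sectorBlock
  rw [Finset.filter_congr fun S _ => h S.card]

/-- The landed `LocalConstancy v` (stub `stub_localConstancy`, hi-side only) is an instance of `LawLocalConstancy v`, given
finiteness of the ground-state energy. -/
theorem localConstancy_of_lawLocalConstancy : ∀ v : ℝ → ENNReal, (∀ (m : ℕ) (L : ℝ), 0 < L → Literature.MathematicalPhysics.QuantumManyBody.BoseGas.periodicGroundStateEnergy v (m + 1) L ≠ ⊤) → LawLocalConstancy v → LocalConstancy v :=
  fun _ hfin h m β L₁ hL₁ => ⟨hfin m L₁ hL₁, fun ε hε => h m (fun j => (1 - β) * (m + 1) ≤ (j : ℝ)) L₁ hL₁ ε hε⟩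

end Summit.AtomisticToContinuum.BoseEinsteinCondensation.Cruxes.GDTransfer.Seeded

end
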